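import Summits.QuantumFields.YangMills.Theorems.BalabanUVNodesN07ChartLinAverageAtRecord
import Literature.MathematicalPhysics.QuantumFieldTheory.Balaban1983to89.B15Prop1DatumCoordinates
import HarnessLib

/-!
# N07 at the record — THE WINDOW ∕ GUARD ∕ A-SIDE LOG-DISC ROWS OF THE (47)-CARRYING CHART IN THE SMALL, BY CONTINUITY, and the average conjunct of the KNIT
# token (rng) for def-Y's (A4) `bgSchemePrOfRecord` with those three displayed rows DISCHARGED

Cell `pub-ymgap`, seat `pub-ymgap-dag-n07-w3` (g28, WIDTH SEAT 3 on N07 [B11]); helper file keyed `--supports stmt-QuantumFields-27238 --as helper` (K0ᴬ road);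
count-neutral.  INTENT-14 of the seat: item (δ) of the seat's LANDED-13 list — the three rows of ✓`…N07ChartLinAverageAtRecord` that hold "by smallness and
continuity near `↑U₀`" are proved so, once, at the datum level and transported to the `A′`-space through the chart field
`A′ ↦ expOver U₀ (η • evLit (T47 H₁^{pr} C^{sl,pr} ε_C A′))` (continuous at `0` with value `↑U₀`: lit ✓`analyticOnNhd_T47`, ✓`T47_zero`).

## What is here

* §1 (datum level; any `𝔥 : FrameDatum (F.P K) N k U₀`, any `U₀` guarded below `k`) ★★ `eventually_rows_nhds_bg` — for matrix fields `Q` near `↑U₀`: (i) `Q ∈ 𝔥.dom`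
  (`𝔥.dom_mem_nhds`), (ii) every `SU(N)` configuration with matrices `Q` is guarded below `k` (lit ✓`B15Prop1DatumCoordinates.eventually_smallBelow` — the guard
  is open), (iii) the A-side log-disc row `∀ c, ‖avPrM 𝔥 Q c · (Ū^kU₀)(c)⋆ − 1‖ < 1` (continuity of the framed average at `↑U₀`, (A2) ✓`analyticAt_avPrM_apply`, where
  its value is `↑(Ū^kU₀)`: ✓`avPrM_bg` + ✓`iterMh_coeField_of_smallBelow`).
* §2 (transport) ★ `tendsto_chartFieldPr_zero` — the chart field tends to `↑U₀` as `A′ → 0`; ★★ `exists_radius_rowsPr` — ONE RADIUS `ρ > 0` (depending on the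
  datum, the background and the Sect. C data only — NOT on the scheme's `ε₄`, `a𝔄`) such that `‖A′‖ < ρ` gives the three rows for the chart field at `A′`.
* §3 (at (A4)'s chart) ★★★ `exists_radius_iter_chartLin_eq_of_map_eq_one` ∕ ★★★ `exists_radius_avPrM_chartLin_eq` — ✓`iter_chartLin_eq_of_map_eq_one` ∕
  ✓`avPrM_chartLin_eq` with the window, guard and A-side log-disc rows REMOVED: for `‖A + 𝔄^{pr}V‖ < ρ` (same `ρ`), `V ∈ logDiscOfRecord`, `Q^{pr}A = 0`, the
  trace row and the `SU`-exponent row (and `h = 1` on the chart field for the un-framed display) ⟹ `Ū^k(𝔖.chartLin T^{pr} V A) = V` ∕ `avPrM 𝔥 ↑(…) = ↑V`;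
  ★★★ `exists_radius_iter_chartCfgLin_eq_of_map_eq_one` — the same AT THE FIXED POINT for every scheme regime with `ε₄ + a𝔄 ≤ ρ` and `V ∈ curedDomPrOfRecord … a𝔄`
  (the framed slice row displayed as in ✓`readFun_Qpr_sol_eq_zero`).

## Honest labels

Continuity bookkeeping on landed letters; REMAINING displayed rows after this file: the two `Regime`s + `Prop4Hyp` (produced in the small by ✓`…N07SectCRegimePrOfRecordSmall`),
`‖J‖ ≤ j`, the framed slice row «`Q^{pr}𝔊^{pr} = 0`», the trace row (`T47 A′` traceless; g27's ✓`trace_equiv_T47OfRecord_eq_zero_two` is the `N = 2` frame-free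
row), the `SU`-valuedness of the exponent (reality + trace), and — for the UN-FRAMED display only — `h = 1` on the chart field (the frameless datum; the frame flag
of ✓`coe_iter_chartLin_eq_frameConj` stands at non-trivial data).  Nothing of Bałaban's estimates; K0ᴬ ⟨27238⟩ NOT closed; N07 NOT discharged; R4 is the conditional
finite-𝕋⁴ rung `BalabanLadder.UV` only; finite torus at fixed `ε` — nothing continuum ∕ OS ∕ Clay.  **The Yang–Mills mass gap is NOT proved by any of this.**
No `sorry`, no `def`, no `instance ∕ notation`; standard axioms.
[cite: Balaban1985Variational, (15) p.280, (20) p.281, (47) p.285, Prop. 3 p.289, Prop. 6 p.295; Balaban1985Averaging, (92) p.31; Balaban1987RG1, (0.4) p.253, (0.21) p.256;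
Balaban1985BackgroundPropagators, (3.113) p.418]
-/

set_option autoImplicit false

noncomputable section

open scoped Matrix Matrix.Norms.L2Operator InnerProductSpace Topology

namespace Summit.QuantumFields.YangMills.Theorems.N07ChartLinRowsSmall

open Filter Metric
open Literature.MathematicalPhysics.QuantumFieldTheory.Balaban1983to89
open Literature.MathematicalPhysics.QuantumFieldTheory.Balaban1983to89.T4Continuum (T4Family)
open Literature.MathematicalPhysics.QuantumFieldTheory.Balaban1983to89.Node00
open BlockAveraging (Idx)
open B15AveragingHolomorphic (iterMh loopMh)
open B15Prop1DatumCoordinates (eventually_smallBelow norm_loopMh_iterMh_lt_of_smallBelow deltaSU_le_one)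
open B11Eq103H1Complex (SiteL2K BondL2K readFun)
open B11Eq111FrakG (nabla115)
open B11Eq115Space (NegSize NegSup JetSup)
open B11Eq174Chart (Regime)
open B11Prop6Scheme (Prop4Hyp)
open B11Eq90V0GroupComposed (T47 T47_zero analyticOnNhd_T47)
open Summit.QuantumFields.YangMills.Theorems.N07ChartLinAverageAtRecord (avPrM_chartLin_eq iter_chartLin_eq_of_map_eq_one norm_sol_add_frakApr_lt readFun_Qpr_sol_eq_zero)

section Record

variable (F : T4Family) (N : ℕ) [NeZero N] (K : ℕ) (k : ℕ) (Ω : ℕ → Set (Site (F.P K) 0)) (U₀ : GaugeField (F.P K) 0 (SU N))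
  [Fact (0 < (F.L : ℝ))] [Fact (0 < (F.P K).eta k)] [Fact (0 < c0Rec F K k)] [Fact (∀ c, 0 < wBRec F K k c)]
  (𝔥 : FrameDatum (F.P K) N k U₀)

/-! ## §1  The three rows near the background's matrices (datum level) -/

omit [Fact (0 < (F.L : ℝ))] [Fact (0 < (F.P K).eta k)] [Fact (0 < c0Rec F K k)] [Fact (∀ c, 0 < wBRec F K k c)] in
/-- ★★ **WINDOW, GUARD AND A-SIDE LOG-DISC ROW HOLD NEAR `↑U₀`**: for matrix fields `Q` near the matrices of a background `U₀` guarded below `k`: `Q` lies in the frame's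
window; every `SU(N)` configuration with matrices `Q` is guarded below `k`; and `‖avPrM 𝔥 Q c · (Ū^kU₀)(c)⋆ − 1‖ < 1` at every level-`k` bond (the framed average is
continuous at `↑U₀` with value `↑(Ū^kU₀)`, unitary). [cite: Balaban1987RG1, (0.4) p.253, (0.21) p.256; Balaban1985Averaging, (92) p.31; Balaban1985Variational, Sect. G p.307] -/
theorem eventually_rows_nhds_bg (hU₀ : SmallBelow (avOfRecord F N K) k U₀) :
    ∀ᶠ Q in 𝓝 (coeField U₀), Q ∈ 𝔥.dom ∧ (∀ U : GaugeField (F.P K) 0 (SU N), coeField U = Q → SmallBelow (avOfRecord F N K) k U) ∧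
      ∀ c : PBond (F.P K) k, ‖avPrM 𝔥 Q c * star (Averaging.iter (avOfRecord F N K) k U₀ c : Matrix (Fin N) (Fin N) ℂ) - 1‖ < 1 := by
  have hdom : ∀ᶠ Q in 𝓝 (coeField U₀), Q ∈ 𝔥.dom := 𝔥.dom_mem_nhds
  have hguard : ∀ᶠ Q in 𝓝 (coeField U₀), ∀ U : GaugeField (F.P K) 0 (SU N), coeField U = Q → SmallBelow (avOfRecord F N K) k U :=
    eventually_smallBelow hU₀
  have hpoly : ∀ j, j < k → ∀ (c : PBond (F.P K) (j + 1)) (i : Idx (F.P K)), ‖loopMh (iterMh j (coeField U₀)) c i - 1‖ < 1 :=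
    fun j hj c i => lt_of_lt_of_le (norm_loopMh_iterMh_lt_of_smallBelow hU₀ j hj c i) deltaSU_le_one
  have hdisc : ∀ c : PBond (F.P K) k,
      ∀ᶠ Q in 𝓝 (coeField U₀), ‖avPrM 𝔥 Q c * star (Averaging.iter (avOfRecord F N K) k U₀ c : Matrix (Fin N) (Fin N) ℂ) - 1‖ < 1 := by
    intro c
    have hcont : ContinuousAt (fun Q : PBond (F.P K) 0 → Matrix (Fin N) (Fin N) ℂ =>
        ‖avPrM 𝔥 Q c * star (Averaging.iter (avOfRecord F N K) k U₀ c : Matrix (Fin N) (Fin N) ℂ) - 1‖) (coeField U₀) :=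
      (((analyticAt_avPrM_apply 𝔥 (mem_of_mem_nhds 𝔥.dom_mem_nhds) hpoly c).continuousAt.mul continuousAt_const).sub continuousAt_const).norm
    have h0 : ‖avPrM 𝔥 (coeField U₀) c * star (Averaging.iter (avOfRecord F N K) k U₀ c : Matrix (Fin N) (Fin N) ℂ) - 1‖ < 1 := by
      rw [avPrM_bg, iterMh_coeField_of_smallBelow F N k U₀ hU₀, coeField_apply, coe_mul_star_coe_SU, sub_self, norm_zero]
      exact one_pos
    exact hcont.tendsto.eventually_lt_const h0
  filter_upwards [hdom, hguard, eventually_all.2 hdisc] with Q h₁ h₂ h₃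
  exact ⟨h₁, h₂, h₃⟩

/-! ## §2  Transport to the `A′`-space through the chart field `A′ ↦ expOver U₀ (η • evLit (T47 H₁^{pr} C^{sl,pr} ε_C A′))` -/

variable (levB : PBond (F.P K) k → ℕ) (a : ℝ)
  (hposb : ∀ x, x ≠ 0 → 0 < RCLike.re ⟪x, laplaceAOfRecord F N k U₀ (QprOfRecord F N k U₀ 𝔥) (QprimeOfRecord F N k U₀) a x⟫_ℂ)
  (hQ : Function.Surjective (QprOfRecord F N k U₀ 𝔥))

/-- ★ **THE CHART FIELD TENDS TO `↑U₀` AS `A′ → 0`** (`T47` continuous at `0` with `T47 0 = 0` under the Sect. C regime — lit ✓`analyticOnNhd_T47`, ✓`T47_zero`;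
`evLit` linear; `expOver U₀` analytic with `expOver U₀ 0 = ↑U₀`). [cite: Balaban1985Variational, (15) p.280, (47) p.285, Prop. 3 p.289] -/
theorem tendsto_chartFieldPr_zero {b C₂ c₄ aC εC : ℝ}
    (RC : Regime (H1prOfRecordAtBg F N K k Ω U₀ 𝔥 levB a hposb hQ) (0 : Space115Lit F N K k Ω U₀ →L[ℂ] Space115Lit F N K k Ω U₀)
      (CslprOfRecord F N K k Ω U₀ 𝔥 levB) b 0 C₂ c₄ 0 aC εC)
    (hC : Prop4Hyp (CslprOfRecord F N K k Ω U₀ 𝔥 levB) C₂ c₄) (haC : 0 < aC) :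
    Tendsto (fun A' : Space115Lit F N K k Ω U₀ => expOver U₀ ((((F.P K).eta k : ℝ) : ℂ) • evLit F N K k Ω U₀
        (T47 (H1prOfRecordAtBg F N K k Ω U₀ 𝔥 levB a hposb hQ) (CslprOfRecord F N K k Ω U₀ 𝔥 levB) εC A'))) (𝓝 0) (𝓝 (coeField U₀)) := by
  have hT : ContinuousAt (T47 (H1prOfRecordAtBg F N K k Ω U₀ 𝔥 levB a hposb hQ) (CslprOfRecord F N K k Ω U₀ 𝔥 levB) εC) 0 :=
    (analyticOnNhd_T47 RC hC 0 (mem_ball_self haC)).continuousAt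
  have hev : AnalyticAt ℂ (fun Y : Space115Lit F N K k Ω U₀ => evLit F N K k Ω U₀ Y)
      (T47 (H1prOfRecordAtBg F N K k Ω U₀ 𝔥 levB a hposb hQ) (CslprOfRecord F N K k Ω U₀ 𝔥 levB) εC 0) :=
    (LinearMap.toContinuousLinearMap (evLit F N K k Ω U₀)).analyticAt _
  have hX : AnalyticAt ℂ (fun Y : Space115Lit F N K k Ω U₀ => (((F.P K).eta k : ℝ) : ℂ) • evLit F N K k Ω U₀ Y)
      (T47 (H1prOfRecordAtBg F N K k Ω U₀ 𝔥 levB a hposb hQ) (CslprOfRecord F N K k Ω U₀ 𝔥 levB) εC 0) := hev.fun_const_smul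
  have h := ((analyticAt_expOver U₀ _).continuousAt.comp (hX.continuousAt.comp hT)).tendsto
  simp only [Function.comp_def, T47_zero RC haC, map_zero, smul_zero, expOver_zero] at h
  exact h

/-- ★★ **ONE RADIUS FOR THE THREE ROWS**: there is `ρ > 0` — depending on the datum, the guarded background and the Sect. C data only — such that for `‖A′‖ < ρ` the
chart field at `A′` lies in the frame's window, every `SU(N)` configuration carrying it is guarded below `k`, and its framed average lies in the log-disc about `Ū^kU₀`.
[cite: Balaban1987RG1, (0.4) p.253, (0.21) p.256; Balaban1985Averaging, (92) p.31; Balaban1985Variational, (47) p.285, Prop. 3 p.289] -/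
theorem exists_radius_rowsPr (hU₀ : SmallBelow (avOfRecord F N K) k U₀) {b C₂ c₄ aC εC : ℝ}
    (RC : Regime (H1prOfRecordAtBg F N K k Ω U₀ 𝔥 levB a hposb hQ) (0 : Space115Lit F N K k Ω U₀ →L[ℂ] Space115Lit F N K k Ω U₀)
      (CslprOfRecord F N K k Ω U₀ 𝔥 levB) b 0 C₂ c₄ 0 aC εC)
    (hC : Prop4Hyp (CslprOfRecord F N K k Ω U₀ 𝔥 levB) C₂ c₄) (haC : 0 < aC) :
    ∃ ρ : ℝ, 0 < ρ ∧ ρ ≤ aC ∧ ∀ A' : Space115Lit F N K k Ω U₀, ‖A'‖ < ρ →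
      expOver U₀ ((((F.P K).eta k : ℝ) : ℂ) • evLit F N K k Ω U₀
          (T47 (H1prOfRecordAtBg F N K k Ω U₀ 𝔥 levB a hposb hQ) (CslprOfRecord F N K k Ω U₀ 𝔥 levB) εC A')) ∈ 𝔥.dom ∧
      (∀ U : GaugeField (F.P K) 0 (SU N), coeField U = expOver U₀ ((((F.P K).eta k : ℝ) : ℂ) • evLit F N K k Ω U₀
          (T47 (H1prOfRecordAtBg F N K k Ω U₀ 𝔥 levB a hposb hQ) (CslprOfRecord F N K k Ω U₀ 𝔥 levB) εC A')) → SmallBelow (avOfRecord F N K) k U) ∧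
      ∀ c : PBond (F.P K) k, ‖avPrM 𝔥 (expOver U₀ ((((F.P K).eta k : ℝ) : ℂ) • evLit F N K k Ω U₀
          (T47 (H1prOfRecordAtBg F N K k Ω U₀ 𝔥 levB a hposb hQ) (CslprOfRecord F N K k Ω U₀ 𝔥 levB) εC A'))) c
        * star (Averaging.iter (avOfRecord F N K) k U₀ c : Matrix (Fin N) (Fin N) ℂ) - 1‖ < 1 := by
  have h := (tendsto_chartFieldPr_zero F N K k Ω U₀ 𝔥 levB a hposb hQ RC hC haC).eventually (eventually_rows_nhds_bg F N K k U₀ 𝔥 hU₀)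
  obtain ⟨ε, hε, hball⟩ := Metric.eventually_nhds_iff.1 h
  refine ⟨min ε aC, lt_min hε haC, min_le_right _ _, fun A' hA' => ?_⟩
  exact hball (by rw [dist_zero_right]; exact lt_of_lt_of_le hA' (min_le_left _ _))

/-! ## §3  At (A4)'s chart: the average conjuncts with the three rows discharged -/

variable (dom : Set (GaugeField (F.P K) k (SU N)))
  (Gp : SiteL2K ℂ (F.P K).d (fun _ => (F.P K).sitesPerDir 0) (c0Rec F K k) (WRec N) →ₗ[ℂ]
    SiteL2K ℂ (F.P K).d (fun _ => (F.P K).sitesPerDir 0) (c0Rec F K k) (WRec N))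
  (Δ2 : BondL2K ℂ (F.P K).d (fun _ => (F.P K).sitesPerDir 0) (c0Rec F K k) (WRec N) →ₗ[ℂ]
    BondL2K ℂ (F.P K).d (fun _ => (F.P K).sitesPerDir 0) (c0Rec F K k) (WRec N))
  (hposπ : ∀ x, x ≠ 0 → 0 < RCLike.re ⟪x, laplaceAOfRecordAt F N k U₀ (hessOpOfRecord128 F N k U₀ Gp (QprimeOfRecord F N k U₀) Δ2)
    (QprOfRecord F N k U₀ 𝔥) (QprimeOfRecord F N k U₀) a x⟫_ℂ) (εC : ℝ)

/-- ★★★ **THE K0ᴬ ROAD's (rng) AVERAGE CONJUNCT AT A CHART POINT, THREE ROWS DISCHARGED**: one radius `ρ > 0` such that for every `V` in the log-disc and every chart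
coordinate `A` with `Q^{pr}A = 0` and `‖A + 𝔄^{pr}V‖ < ρ`, the trace row, the `SU`-exponent row and `h = 1` on the chart field give `Ū^k(𝔖.chartLin T^{pr} V A) = V` —
for ALL scheme parameters `B₀ C₄ a₃ j a𝔄 ε₄`. [cite: Balaban1985Variational, (15) p.280, (20) p.281, (44)–(48) p.285; Balaban1987RG1, (0.21) p.256; Balaban1985Averaging, (92) p.31] -/
theorem exists_radius_iter_chartLin_eq_of_map_eq_one (hU₀ : SmallBelow (avOfRecord F N K) k U₀) {b C₂ c₄ aC : ℝ}
    (RC : Regime (H1prOfRecordAtBg F N K k Ω U₀ 𝔥 levB a hposb hQ) (0 : Space115Lit F N K k Ω U₀ →L[ℂ] Space115Lit F N K k Ω U₀)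
      (CslprOfRecord F N K k Ω U₀ 𝔥 levB) b 0 C₂ c₄ 0 aC εC)
    (hC : Prop4Hyp (CslprOfRecord F N K k Ω U₀ 𝔥 levB) C₂ c₄) (haC : 0 < aC) :
    ∃ ρ : ℝ, 0 < ρ ∧ ρ ≤ aC ∧ ∀ (B₀ C₄ a₃ j a𝔄 ε₄ : ℝ) {V : GaugeField (F.P K) k (SU N)}, V ∈ logDiscOfRecord F N K k U₀ →
      ∀ {A : Space115Lit F N K k Ω U₀}, ‖A + frakAprOfRecordAtBg128 F N K k Ω U₀ 𝔥 levB Gp Δ2 a hposπ hQ V‖ < ρ →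
      readFun (phiRec N) _ (wBRec F K k) (QprOfRecord F N k U₀ 𝔥) (JetSup.equiv _ _ (nabla115 ((F.P K).eta k) (unitsOfRecord F N U₀)) A) = 0 →
      (∀ b', (JetSup.equiv _ _ (nabla115 ((F.P K).eta k) (unitsOfRecord F N U₀))
        (T47 (H1prOfRecordAtBg F N K k Ω U₀ 𝔥 levB a hposb hQ) (CslprOfRecord F N K k Ω U₀ 𝔥 levB) εC
          (A + frakAprOfRecordAtBg128 F N K k Ω U₀ 𝔥 levB Gp Δ2 a hposπ hQ V)) b').trace = 0) →
      (∀ b', (bgSchemePrOfRecord F N K k Ω U₀ 𝔥 dom levB Gp Δ2 a hposπ hposb hQ εC B₀ C₄ a₃ j a𝔄 ε₄).expoLinAt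
        (linPrOfRecord F N K k Ω U₀ 𝔥 levB a hposb hQ εC) V A b' ∈ Matrix.specialUnitaryGroup (Fin N) ℂ) →
      𝔥.map (coeField ((bgSchemePrOfRecord F N K k Ω U₀ 𝔥 dom levB Gp Δ2 a hposπ hposb hQ εC B₀ C₄ a₃ j a𝔄 ε₄).chartLin
        (linPrOfRecord F N K k Ω U₀ 𝔥 levB a hposb hQ εC) V A)) = 1 →
      Averaging.iter (avOfRecord F N K) k ((bgSchemePrOfRecord F N K k Ω U₀ 𝔥 dom levB Gp Δ2 a hposπ hposb hQ εC B₀ C₄ a₃ j a𝔄 ε₄).chartLin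
        (linPrOfRecord F N K k Ω U₀ 𝔥 levB a hposb hQ εC) V A) = V := by
  obtain ⟨ρ, hρ, hρaC, hrows⟩ := exists_radius_rowsPr F N K k Ω U₀ 𝔥 levB a hposb hQ hU₀ RC hC haC
  refine ⟨ρ, hρ, hρaC, fun B₀ C₄ a₃ j a𝔄 ε₄ V hV A hA hQA htr hSU hmap => ?_⟩
  obtain ⟨hW, hguard, hdiscA⟩ := hrows _ hA
  have hcoe := coeField_chartLin_eq_expOver F N K k Ω U₀ 𝔥 dom levB Gp Δ2 a hposπ hposb hQ εC B₀ C₄ a₃ j a𝔄 ε₄ V A hSU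
  rw [← hcoe] at hW hdiscA
  exact iter_chartLin_eq_of_map_eq_one F N K k Ω U₀ 𝔥 dom levB Gp Δ2 a hposπ hposb hQ εC B₀ C₄ a₃ j a𝔄 ε₄ RC hV (lt_of_lt_of_le hA hρaC) hQA htr hSU hW hmap
    (hguard _ hcoe) hdiscA

/-- ★★★ **THE FRAMED AVERAGE CONJUNCT AT A CHART POINT, ROWS DISCHARGED** (any datum): with the same radius, `avPrM 𝔥 ↑(𝔖.chartLin T^{pr} V A) = ↑V`.
[cite: Balaban1985Variational, (20) p.281, (44)–(48) p.285; Balaban1985Averaging, (92) p.31; Balaban1985BackgroundPropagators, (3.113) p.418] -/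
theorem exists_radius_avPrM_chartLin_eq (hU₀ : SmallBelow (avOfRecord F N K) k U₀) {b C₂ c₄ aC : ℝ}
    (RC : Regime (H1prOfRecordAtBg F N K k Ω U₀ 𝔥 levB a hposb hQ) (0 : Space115Lit F N K k Ω U₀ →L[ℂ] Space115Lit F N K k Ω U₀)
      (CslprOfRecord F N K k Ω U₀ 𝔥 levB) b 0 C₂ c₄ 0 aC εC)
    (hC : Prop4Hyp (CslprOfRecord F N K k Ω U₀ 𝔥 levB) C₂ c₄) (haC : 0 < aC) :
    ∃ ρ : ℝ, 0 < ρ ∧ ρ ≤ aC ∧ ∀ (B₀ C₄ a₃ j a𝔄 ε₄ : ℝ) {V : GaugeField (F.P K) k (SU N)}, V ∈ logDiscOfRecord F N K k U₀ →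
      ∀ {A : Space115Lit F N K k Ω U₀}, ‖A + frakAprOfRecordAtBg128 F N K k Ω U₀ 𝔥 levB Gp Δ2 a hposπ hQ V‖ < ρ →
      readFun (phiRec N) _ (wBRec F K k) (QprOfRecord F N k U₀ 𝔥) (JetSup.equiv _ _ (nabla115 ((F.P K).eta k) (unitsOfRecord F N U₀)) A) = 0 →
      (∀ b', (JetSup.equiv _ _ (nabla115 ((F.P K).eta k) (unitsOfRecord F N U₀))
        (T47 (H1prOfRecordAtBg F N K k Ω U₀ 𝔥 levB a hposb hQ) (CslprOfRecord F N K k Ω U₀ 𝔥 levB) εC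
          (A + frakAprOfRecordAtBg128 F N K k Ω U₀ 𝔥 levB Gp Δ2 a hposπ hQ V)) b').trace = 0) →
      (∀ b', (bgSchemePrOfRecord F N K k Ω U₀ 𝔥 dom levB Gp Δ2 a hposπ hposb hQ εC B₀ C₄ a₃ j a𝔄 ε₄).expoLinAt
        (linPrOfRecord F N K k Ω U₀ 𝔥 levB a hposb hQ εC) V A b' ∈ Matrix.specialUnitaryGroup (Fin N) ℂ) →
      avPrM 𝔥 (coeField ((bgSchemePrOfRecord F N K k Ω U₀ 𝔥 dom levB Gp Δ2 a hposπ hposb hQ εC B₀ C₄ a₃ j a𝔄 ε₄).chartLin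
        (linPrOfRecord F N K k Ω U₀ 𝔥 levB a hposb hQ εC) V A)) = coeField V := by
  obtain ⟨ρ, hρ, hρaC, hrows⟩ := exists_radius_rowsPr F N K k Ω U₀ 𝔥 levB a hposb hQ hU₀ RC hC haC
  refine ⟨ρ, hρ, hρaC, fun B₀ C₄ a₃ j a𝔄 ε₄ V hV A hA hQA htr hSU => ?_⟩
  obtain ⟨-, -, hdiscA⟩ := hrows _ hA
  rw [← coeField_chartLin_eq_expOver F N K k Ω U₀ 𝔥 dom levB Gp Δ2 a hposπ hposb hQ εC B₀ C₄ a₃ j a𝔄 ε₄ V A hSU] at hdiscA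
  exact avPrM_chartLin_eq F N K k Ω U₀ 𝔥 dom levB Gp Δ2 a hposπ hposb hQ εC B₀ C₄ a₃ j a𝔄 ε₄ RC hV (lt_of_lt_of_le hA hρaC) hQA htr hSU hdiscA

/-- ★★★ **THE K0ᴬ ROAD's (rng) ∧ (star_mem) AVERAGE CONJUNCT AT THE FIXED POINT, THREE ROWS DISCHARGED**: with the same radius `ρ`, for EVERY scheme regime whose ball and
shift fit (`ε₄ + a𝔄 ≤ ρ`), every `V ∈ curedDomPrOfRecord … a𝔄` has `Ū^k(𝔖.chartCfgLin T^{pr} V) = V`, given the framed slice row, the trace row, the `SU`-exponent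
row and `h = 1` on the chart field. [cite: Balaban1985Variational, (20) p.281, (109)–(111) p.294, Prop. 6 (115)–(116) p.295; Balaban1987RG1, (0.21) p.256] -/
theorem exists_radius_iter_chartCfgLin_eq_of_map_eq_one (hU₀ : SmallBelow (avOfRecord F N K) k U₀) {b C₂ c₄ aC : ℝ}
    (RC : Regime (H1prOfRecordAtBg F N K k Ω U₀ 𝔥 levB a hposb hQ) (0 : Space115Lit F N K k Ω U₀ →L[ℂ] Space115Lit F N K k Ω U₀)
      (CslprOfRecord F N K k Ω U₀ 𝔥 levB) b 0 C₂ c₄ 0 aC εC)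
    (hC : Prop4Hyp (CslprOfRecord F N K k Ω U₀ 𝔥 levB) C₂ c₄) (haC : 0 < aC) :
    ∃ ρ : ℝ, 0 < ρ ∧ ρ ≤ aC ∧ ∀ (B₀ C₄ a₃ j a𝔄 ε₄ : ℝ), ε₄ + a𝔄 ≤ ρ →
      Regime (frakGprOfRecordAtBg128 F N K k Ω U₀ 𝔥 Gp Δ2 a hposπ hQ) (0 : Space115Lit F N K k Ω U₀ →L[ℂ] Space115Lit F N K k Ω U₀)
        (WprOfRecordAt F N K k Ω U₀ 𝔥 levB a hposb hQ εC Gp) B₀ 0 C₄ a₃ j a𝔄 ε₄ →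
      ‖JOfRecordAtBg F N K k Ω U₀‖ ≤ j →
      (∀ f, readFun (phiRec N) _ (wBRec F K k) (QprOfRecord F N k U₀ 𝔥)
        (JetSup.equiv _ _ (nabla115 ((F.P K).eta k) (unitsOfRecord F N U₀)) (frakGprOfRecordAtBg128 F N K k Ω U₀ 𝔥 Gp Δ2 a hposπ hQ f)) = 0) →
      ∀ {V : GaugeField (F.P K) k (SU N)}, V ∈ curedDomPrOfRecord F N K k Ω U₀ 𝔥 levB Gp Δ2 a hposπ hQ a𝔄 →
      (∀ b', (JetSup.equiv _ _ (nabla115 ((F.P K).eta k) (unitsOfRecord F N U₀))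
        (T47 (H1prOfRecordAtBg F N K k Ω U₀ 𝔥 levB a hposb hQ) (CslprOfRecord F N K k Ω U₀ 𝔥 levB) εC
          ((bgSchemePrOfRecord F N K k Ω U₀ 𝔥 dom levB Gp Δ2 a hposπ hposb hQ εC B₀ C₄ a₃ j a𝔄 ε₄).sol V +
            frakAprOfRecordAtBg128 F N K k Ω U₀ 𝔥 levB Gp Δ2 a hposπ hQ V)) b').trace = 0) →
      (∀ b', (bgSchemePrOfRecord F N K k Ω U₀ 𝔥 dom levB Gp Δ2 a hposπ hposb hQ εC B₀ C₄ a₃ j a𝔄 ε₄).expoLinAt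
        (linPrOfRecord F N K k Ω U₀ 𝔥 levB a hposb hQ εC) V
          ((bgSchemePrOfRecord F N K k Ω U₀ 𝔥 dom levB Gp Δ2 a hposπ hposb hQ εC B₀ C₄ a₃ j a𝔄 ε₄).sol V) b' ∈ Matrix.specialUnitaryGroup (Fin N) ℂ) →
      𝔥.map (coeField ((bgSchemePrOfRecord F N K k Ω U₀ 𝔥 dom levB Gp Δ2 a hposπ hposb hQ εC B₀ C₄ a₃ j a𝔄 ε₄).chartCfgLin
        (linPrOfRecord F N K k Ω U₀ 𝔥 levB a hposb hQ εC) V)) = 1 →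
      Averaging.iter (avOfRecord F N K) k ((bgSchemePrOfRecord F N K k Ω U₀ 𝔥 dom levB Gp Δ2 a hposπ hposb hQ εC B₀ C₄ a₃ j a𝔄 ε₄).chartCfgLin
        (linPrOfRecord F N K k Ω U₀ 𝔥 levB a hposb hQ εC) V) = V := by
  obtain ⟨ρ, hρ, hρaC, h⟩ := exists_radius_iter_chartLin_eq_of_map_eq_one F N K k Ω U₀ 𝔥 levB a hposb hQ dom Gp Δ2 hposπ εC hU₀ RC hC haC
  refine ⟨ρ, hρ, hρaC, fun B₀ C₄ a₃ j a𝔄 ε₄ hfit R hJ h𝔊 V hV htr hSU hmap => ?_⟩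
  have h𝔄 := norm_frakApr_lt_of_mem_curedDomPrOfRecord F N K k Ω U₀ 𝔥 levB Gp Δ2 a hposπ hQ hV
  rw [← BgScheme.chartLin_sol] at hmap ⊢
  exact h B₀ C₄ a₃ j a𝔄 ε₄ (curedDomPrOfRecord_subset_logDisc F N K k Ω U₀ 𝔥 levB Gp Δ2 a hposπ hQ a𝔄 hV)
    (norm_sol_add_frakApr_lt F N K k Ω U₀ 𝔥 dom levB Gp Δ2 a hposπ hposb hQ εC B₀ C₄ a₃ j a𝔄 ε₄ R hJ h𝔄 hfit)
    (readFun_Qpr_sol_eq_zero F N K k Ω U₀ 𝔥 dom levB Gp Δ2 a hposπ hposb hQ εC B₀ C₄ a₃ j a𝔄 ε₄ R hJ h𝔄 h𝔊) htr hSU hmap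

end Record

end Summit.QuantumFields.YangMills.Theorems.N07ChartLinRowsSmall

end
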